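import Literature.MathematicalPhysics.QuantumFieldTheory.Balaban1983to89.B6CoverBox
import Literature.MathematicalPhysics.QuantumFieldTheory.Balaban1983to89.B6BoxChartsNested

/-!
# `Balaban1983to89.B6CoverNested` — T. Bałaban, *Propagators and renormalization transformations for lattice gauge
theories. II*, Commun. Math. Phys. **96** (1984) 223–250 [Balaban1984PropagatorsII]: the cube cover 𝒟 = ⋃_{j=0}^{k} 𝒟_j of
p. 229 and its partition of unity (2.36), Σ_{□∈𝒟} h_□² = 1, on the (k+1)-LEVEL NESTED CUBE-UNION GEOMETRY of
`…B6BoxChartsNested` (profile h of [Balaban1984PropagatorsI] (1.118) p. 36, the explicit choice of `…B6CoverBox`)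

statement-level skeleton of published theorems with citation tags; proofs where landed; nothing here is a claim about the Yang–Mills mass gap

PDF held: `paper:balaban1984-cmp96-propagators-rt-ii` (journal page = PDF page + 222), `paper:balaban1984-cmp95-propagators-rt-i`
(+ 16); renders of [B6] pp. 224, 229 and [B5] p. 36 re-read AS IMAGES this session (`…/pub-balaban/b2b-balaban-ref1/pages/`).

WHAT IS REPRODUCED.  SKELETON row **B6.Eq2.36** (cell `lit-balaban`, HOME `run/shared/lean/pub/lit-balaban/`, Phase-2 seat
p02 = unit `lit-balaban-p02`, PHASE2-TARGETS.md §G.3, nominated by r03).  [B6] p. 229: *"Each set Λ_j is a sum of big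
blocks of the size ML^jη … We cover B^j(Λ_j) by a sum of cubes □ of the size 2ML^jη, each cube being a sum of 2^d big blocks
with a center y ∈ Λ_j (more exactly it belongs to the boundary of this set also). Taking these covers for all j from 0 to k
we get a family 𝒟 of cubes □ of different sizes and such that T_η = ⋃_{□∈𝒟} □. We will identify this family of cubes with
the set of centers of these cubes. We construct also the corresponding family of functions h described in (1.118), and
rescale them to proper scales. They satisfy Σ_{□∈𝒟} h_□² = 1. (2.36)"*; p. 224 (2.3)–(2.4): *"Λ_j = Ω_j^{(j)}∖Ω_{j+1}^{(j)},
j = 1, …, k − 1, Λ_k = Ω_k^{(k)}, Λ₀ = Ω₁ᶜ … T = ⋃_{j=0}^k B^j(Λ_j)"*; [B5] (1.118): *"h_z(x) = Π_{μ=1}^d h((x_μ − z_μ)∕M₀) …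
h is chosen in such a way that Σ_n h²(t − n) = 1, hence Σ_z h_z²(x) = 1."*

THE MODEL INSTANCE (kind «model-instance»; the row's decls of record are the box ∕ two-level ∕ box-tower models
`…B6CoverBox.sum_hprof_sq`, `…B6CoverTwoLevel.sum_hfun_sq`, `…B6TowerCover.sum_hfun_sq`).  Carrier ℤ^d = `Site d` (η = 1)
with the data of `…B6BoxChartsNested`: domains Ω : ℕ → Set ℤ^d (hypotheses `Nested` (2.1), `CubeUnions` (2.2)) and PRINT'S
LEVEL `pzLevel` (greatest j ≤ k with x ∈ Ω_j): B^j(Λ_j) = `terr k Ω j` = {pzLevel = j} (= Ω₁ᶜ, Ω_j∖Ω_{j+1}, Ω_k: §5); 𝒟_j =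
the cubes of side 2M₀L^j centred at the M₀L^j-lattice points c = (M₀L^j)·n whose open cube {|x_μ − c_μ| < M₀L^j} (the 2^d
big blocks at c) meets B^j(Λ_j) (`IsCtr`, the printed *"center y ∈ Λ_j (… boundary … also)"*); h̃_□ = the (1.118)-product
at side M₀L^j (`htl`); h_□ := h̃_□·S^{−1∕2}, S := Σ_{□∈𝒟} h̃_□² (`hfun`, `sqS`) — the tree's matching convention across the
interfaces ∂Λ_{j+1} (DIVERGENCE D-b06.38 ∕ D-b06.42: *"rescale them to proper scales"* does not say how adjacent levels'
families are matched; their plain sum is 2 at an interface corner, `…B6CoverTwoLevel.sqS_corner_eq_two`).  Part 2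
(`…B6CoverNestedPart2`): finite overlap, the bulk (h = h̃), the big-block structure of B^j(Λ_j) and of 𝒟_j under `CubeUnions`.

PROVED (no `sorry`; standard axioms).  §1 (1.118) on the line at lattice arguments (Σ_n h((a − sn)∕s)² = 1 over the two
translates n ∈ {⌊a∕s⌋, ⌊a∕s⌋+1}, all others vanish) and on ℤ^d by tensorisation (`sum_win_prof_sq`, `sum_winZ_bumpZ_sq`).  §3
LEVEL BY LEVEL: on B^j(Λ_j) the family 𝒟_j ALONE has Σ h̃_□² = 1 EXACTLY (`levelSum_eq_one`; no hypothesis on Ω: a translate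
non-zero at x is centred within ⅔M₀L^j of x, so its cube meets B^j(Λ_j) at x), every other level gives ≤ 1, so 1 ≤ S ≤ k + 1,
S is a finite sum over ≤ (k+1)·2^d candidates (`sqS_eq_sum_near`, `sqS_eq_finsum`), and **(2.36): Σ_{□∈𝒟} h_□(x)² = 1 at
EVERY η-point, for EVERY k, L ≥ 1, M₀ ≥ 1 and EVERY Ω** (`sum_h_sq_eq_one`, a `finsum` over all cube indices; finite forms
`sum_hfun_sq_near`, `sum_hfun_sq_of_near_subset`).  §4 T = ⋃□, supp h_□ ⊂ □, 0 ≤ h_□ ≤ 1.  §5 (2.3) in the model (`Nested`).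

HONEST SCOPE.  Modelling leaf on the infinite lattice ℤ^d (𝒟 infinite but locally finite; no torus); h Lipschitz, not C₀^∞;
the normalisation is the tree's convention, the printed-and-proved content free of it is `levelSum_eq_one`.  Nothing on G′, R
of (2.37)–(2.38), on interface Lipschitz ∕ overlap constants (`…B6TowerCover`), on d = 4 or the continuum; NOT summit progress.
-/

namespace Literature.MathematicalPhysics.QuantumFieldTheory.Balaban1983to89.B6CoverNested

open Finset Real
open Literature.Probability.LatticeModels
open B6CoverBox (prof prof_nonneg prof_le_one abs_lt_of_prof_ne_zero prof_of_le_abs prof_sq_add_prof_sq)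
open B6BoxChartsNested (pzLevel pzLevel_le le_pzLevel not_mem_of_pzLevel_lt mem_of_le_pzLevel Nested)

/-! ## §1  [B5] (1.118) on the whole line and on ℤ^d -/

section OneDim

variable {s : ℕ}

/-- The two translates n ∈ {⌊a∕s⌋, ⌊a∕s⌋ + 1} of the side-s profile that can be non-zero at the integer coordinate a.
[cite: Balaban1984PropagatorsI, (1.118) p.36] -/
def win (s : ℕ) (a : ℤ) : Finset ℤ := {a / (s : ℤ), a / (s : ℤ) + 1}

/-- (a − sn)∕s = (a mod s)∕s + ⌊a∕s⌋ − n. [folklore] -/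
private theorem arg_eq (hs : 0 < s) (a n : ℤ) :
    (((a - (s : ℤ) * n : ℤ)) : ℝ) / (s : ℝ) = ((a % (s : ℤ) : ℤ) : ℝ) / (s : ℝ) + (((a / (s : ℤ) : ℤ)) : ℝ) - (n : ℝ) := by
  have hs' : (s : ℝ) ≠ 0 := by exact_mod_cast hs.ne'
  have h' : ((a % (s : ℤ) : ℤ) : ℝ) = (a : ℝ) - (s : ℝ) * (((a / (s : ℤ) : ℤ)) : ℝ) := by
    exact_mod_cast Int.emod_def a (s : ℤ)
  have e : (((a - (s : ℤ) * n : ℤ)) : ℝ) = ((a % (s : ℤ) : ℤ) : ℝ) + (s : ℝ) * ((((a / (s : ℤ) : ℤ)) : ℝ) - (n : ℝ)) := by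
    push_cast
    linear_combination (-1 : ℝ) * h'
  rw [e, add_div, mul_div_cancel_left₀ _ hs', add_sub_assoc]

/-- 0 ≤ (a mod s)∕s < 1. [folklore] -/
private theorem rho_bounds (hs : 0 < s) (a : ℤ) :
    0 ≤ ((a % (s : ℤ) : ℤ) : ℝ) / (s : ℝ) ∧ ((a % (s : ℤ) : ℤ) : ℝ) / (s : ℝ) < 1 := by
  have hs' : (0 : ℝ) < s := by exact_mod_cast hs
  refine ⟨div_nonneg (by exact_mod_cast Int.emod_nonneg a (by exact_mod_cast hs.ne')) hs'.le, ?_⟩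
  rw [div_lt_iff₀ hs', one_mul]
  exact_mod_cast Int.emod_lt_of_pos a (by exact_mod_cast hs)

/-- **(1.118) on the whole line**, *"Σ_n h²(t − n) = 1"*, at the lattice arguments t = a∕s: the two surviving terms are
h(ρ)² + h(ρ − 1)² = 1, ρ = (a mod s)∕s ∈ [0, 1) (`B6CoverBox.prof_sq_add_prof_sq`). [cite: Balaban1984PropagatorsI, (1.118) p.36] -/
theorem sum_win_prof_sq (hs : 0 < s) (a : ℤ) :
    ∑ n ∈ win s a, prof ((((a - (s : ℤ) * n) : ℤ) : ℝ) / s) ^ 2 = 1 := by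
  obtain ⟨hρ0, hρ1⟩ := rho_bounds hs a
  rw [win, Finset.sum_pair (lt_add_one _).ne, arg_eq hs, arg_eq hs]
  push_cast
  rw [add_sub_cancel_right, show ∀ ρ b : ℝ, ρ + b - (b + 1) = ρ - 1 from fun ρ b => by ring]
  exact prof_sq_add_prof_sq hρ0 hρ1.le

/-- Every other translate vanishes: h((a − sn)∕s) = 0 for n ∉ {⌊a∕s⌋, ⌊a∕s⌋ + 1} (*"h ∈ C₀^∞(]−⅔, ⅔[)"*).
[cite: Balaban1984PropagatorsI, (1.118) p.36] -/
theorem prof_eq_zero_of_not_mem_win (hs : 0 < s) {a n : ℤ} (hn : n ∉ win s a) :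
    prof ((((a - (s : ℤ) * n) : ℤ) : ℝ) / s) = 0 := by
  obtain ⟨hρ0, hρ1⟩ := rho_bounds hs a
  have hb : n ≤ a / (s : ℤ) - 1 ∨ a / (s : ℤ) + 2 ≤ n := by
    simp only [win, Finset.mem_insert, Finset.mem_singleton] at hn
    omega
  rw [arg_eq hs]
  apply prof_of_le_abs
  rcases hb with h | h
  · have h1 : (n : ℝ) ≤ (((a / (s : ℤ) : ℤ)) : ℝ) - 1 := by exact_mod_cast h
    rw [abs_of_nonneg (by linarith)]
    linarith
  · have h1 : (((a / (s : ℤ) : ℤ)) : ℝ) + 2 ≤ (n : ℝ) := by exact_mod_cast h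
    rw [abs_of_nonpos (by linarith)]
    linarith

variable {d : ℕ}

/-- **h̃ of side s centred at the s-lattice point s·n**, at the η-point x ∈ ℤ^d: Π_μ h((x_μ − s n_μ)∕s) (printed
*"h_z(x) = Π_{μ=1}^d h((x_μ − z_μ)∕M₀)"*, M₀ ↦ s, z ↦ s·n). [cite: Balaban1984PropagatorsI, (1.118) p.36] -/
noncomputable def bumpZ (s : ℕ) (n x : Site d) : ℝ := ∏ μ, prof ((((x μ - (s : ℤ) * n μ) : ℤ) : ℝ) / s)

/-- The ≤ 2^d centre indices n (n_μ ∈ {⌊x_μ∕s⌋, ⌊x_μ∕s⌋ + 1}) whose profile can be non-zero at x. [cite: Balaban1984PropagatorsI, (1.118) p.36] -/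
def winZ (s : ℕ) (x : Site d) : Finset (Site d) := Fintype.piFinset fun μ => win s (x μ)

/-- h̃_{s,n}(x) = 0 unless n lies in the window of x. [cite: Balaban1984PropagatorsI, (1.118) p.36] -/
theorem bumpZ_eq_zero_of_not_mem_winZ (hs : 0 < s) {n x : Site d} (hn : n ∉ winZ s x) : bumpZ s n x = 0 := by
  rw [winZ, Fintype.mem_piFinset] at hn
  obtain ⟨μ, hμ⟩ := not_forall.1 hn
  exact Finset.prod_eq_zero (Finset.mem_univ μ) (prof_eq_zero_of_not_mem_win hs hμ)

/-- **(1.118) on ℤ^d**, *"hence Σ_z h_z²(x) = 1"*: Σ_n h̃_{s,n}(x)² = 1 at every point, every side s ≥ 1 (the window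
identities tensorised, `Finset.prod_univ_sum`). [cite: Balaban1984PropagatorsI, (1.118) p.36] -/
theorem sum_winZ_bumpZ_sq (hs : 0 < s) (x : Site d) : ∑ n ∈ winZ s x, bumpZ s n x ^ 2 = 1 := by
  calc ∑ n ∈ winZ s x, bumpZ s n x ^ 2
      = ∑ n ∈ Fintype.piFinset (fun μ => win s (x μ)), ∏ μ, prof ((((x μ - (s : ℤ) * n μ) : ℤ) : ℝ) / s) ^ 2 :=
        Finset.sum_congr rfl fun n _ => by rw [bumpZ, Finset.prod_pow]
    _ = ∏ μ : Fin d, ∑ m ∈ win s (x μ), prof ((((x μ - (s : ℤ) * m) : ℤ) : ℝ) / s) ^ 2 :=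
        (Finset.prod_univ_sum (fun μ => win s (x μ))
          (fun μ m => prof ((((x μ - (s : ℤ) * m) : ℤ) : ℝ) / s) ^ 2)).symm
    _ = 1 := Finset.prod_eq_one fun μ _ => sum_win_prof_sq hs (x μ)

/-- 0 ≤ h̃ ≤ 1. [cite: Balaban1984PropagatorsI, (1.118) p.36] -/
theorem bumpZ_mem_Icc (s : ℕ) (n x : Site d) : bumpZ s n x ∈ Set.Icc (0 : ℝ) 1 :=
  ⟨Finset.prod_nonneg fun _ _ => prof_nonneg _, Finset.prod_le_one (fun _ _ => prof_nonneg _) fun _ _ => prof_le_one _⟩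

/-- supp h̃_{s,n} ⊂ the open (4s∕3)-cube about s·n: h̃_{s,n}(x) ≠ 0 ⟹ 3|x_μ − s n_μ| < 2s (*"h ∈ C₀^∞(]−⅔, ⅔[)"*).
[cite: Balaban1984PropagatorsI, (1.118) p.36] -/
theorem abs_lt_of_bumpZ_ne_zero (hs : 0 < s) {n x : Site d} (h : bumpZ s n x ≠ 0) (μ : Fin d) :
    3 * |x μ - (s : ℤ) * n μ| < 2 * (s : ℤ) := by
  have hs' : (0 : ℝ) < s := by exact_mod_cast hs
  have hfac : prof ((((x μ - (s : ℤ) * n μ) : ℤ) : ℝ) / s) ≠ 0 :=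
    fun h0 => h (Finset.prod_eq_zero (Finset.mem_univ μ) h0)
  have h1 := abs_lt_of_prof_ne_zero hfac
  rw [abs_div, abs_of_pos hs', div_lt_iff₀ hs'] at h1
  have h3 : 3 * |(((x μ - (s : ℤ) * n μ) : ℤ) : ℝ)| < 2 * (s : ℝ) := by linarith
  exact_mod_cast h3

end OneDim

/-! ## §2  The objects on the nested geometry: B^j(Λ_j), 𝒟_j, 𝒟, □, h̃_□, S, h_□ -/

section Cover

variable {d : ℕ} {k L M₀ : ℕ} {Ω : ℕ → Set (Site d)}

/-- The side M₀L^j (η-units) of a big block of level j, *"big blocks of the size ML^jη"*. [cite: Balaban1984PropagatorsII, p.229 before (2.36)] -/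
def side (L M₀ j : ℕ) : ℕ := M₀ * L ^ j

/-- M₀L^j ≥ 1. [cite: Balaban1984PropagatorsII, p.229 before (2.36)] -/
theorem side_pos (hL : 1 ≤ L) (hM₀ : 1 ≤ M₀) (j : ℕ) : 0 < side L M₀ j := Nat.mul_pos hM₀ (Nat.pow_pos hL)

/-- **B^j(Λ_j) as a set of η-points** (the territory of level j): print-level `pzLevel` = j; by (2.3)–(2.4) this is Ω₁ᶜ,
Ω_j∖Ω_{j+1}, Ω_k (`terr_zero`, `terr_mid`, `terr_top`). [cite: Balaban1984PropagatorsII, (2.3) p.224] -/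
def terr (k : ℕ) (Ω : ℕ → Set (Site d)) (j : ℕ) : Set (Site d) := {x | pzLevel k Ω x = j}

/-- Membership in B^j(Λ_j). [cite: Balaban1984PropagatorsII, (2.3) p.224] -/
theorem mem_terr {j : ℕ} {x : Site d} : x ∈ terr k Ω j ↔ pzLevel k Ω x = j := Iff.rfl

/-- (2.4), T = ⋃_j B^j(Λ_j): every point lies in the territory of its level. [cite: Balaban1984PropagatorsII, (2.4) p.224] -/
theorem mem_terr_pzLevel (x : Site d) : x ∈ terr k Ω (pzLevel k Ω x) := rfl
/-- Only the levels 0, …, k have territory. [cite: Balaban1984PropagatorsII, (2.4) p.224] -/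
theorem le_of_mem_terr {j : ℕ} {x : Site d} (h : x ∈ terr k Ω j) : j ≤ k := mem_terr.1 h ▸ pzLevel_le x

/-- **The centres of 𝒟_j**: the M₀L^j-lattice point (M₀L^j)·n is one iff its open cube {|x_μ − (M₀L^j)n_μ| < M₀L^j} (the 2^d
big blocks around it) meets B^j(Λ_j) — *"… with a center y ∈ Λ_j (more exactly it belongs to the boundary of this set
also)"*. [cite: Balaban1984PropagatorsII, p.229 before (2.36)] -/
def IsCtr (k L M₀ : ℕ) (Ω : ℕ → Set (Site d)) (j : ℕ) (n : Site d) : Prop :=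
  ∃ x ∈ terr k Ω j, ∀ μ, |x μ - (side L M₀ j : ℤ) * n μ| < side L M₀ j

/-- **𝒟 = ⋃_{j=0}^k 𝒟_j**, a cube = (its level, its centre index) (*"We will identify this family of cubes with the set of
centers of these cubes"*). [cite: Balaban1984PropagatorsII, p.229 before (2.36)] -/
def cover (k L M₀ : ℕ) (Ω : ℕ → Set (Site d)) : Set (ℕ × Site d) := {q | IsCtr k L M₀ Ω q.1 q.2}

/-- x ∈ □ for □ = (j, n) *"of the size 2ML^jη"*: |x_μ − (M₀L^j)n_μ| ≤ M₀L^j. [cite: Balaban1984PropagatorsII, p.229 before (2.36)] -/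
def InCube (L M₀ : ℕ) (q : ℕ × Site d) (x : Site d) : Prop := ∀ μ, |x μ - (side L M₀ q.1 : ℤ) * q.2 μ| ≤ side L M₀ q.1

open Classical in
/-- **h̃_□**, the (1.118)-family *"rescale[d] to proper scales"*: for □ = (j, n) ∈ 𝒟 the product of side M₀L^j centred at
(M₀L^j)·n; extended by 0 to pairs ∉ 𝒟, so that sums over 𝒟 are sums over all pairs. [cite: Balaban1984PropagatorsII, p.229 before (2.36)] -/
noncomputable def htl (k L M₀ : ℕ) (Ω : ℕ → Set (Site d)) (q : ℕ × Site d) (x : Site d) : ℝ :=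
  if q ∈ cover k L M₀ Ω then bumpZ (side L M₀ q.1) q.2 x else 0

/-- **S(x) := Σ_{□∈𝒟} h̃_□(x)²** as the finite double sum over levels j ≤ k and candidate centres (= the sum over all of 𝒟,
`sqS_eq_finsum`). [cite: Balaban1984PropagatorsII, (2.36) p.229] -/
noncomputable def sqS (k L M₀ : ℕ) (Ω : ℕ → Set (Site d)) (x : Site d) : ℝ :=
  ∑ j ∈ Finset.range (k + 1), ∑ n ∈ winZ (side L M₀ j) x, htl k L M₀ Ω (j, n) x ^ 2

/-- **h_□ := h̃_□·S^{−1∕2}**, the partition of unity of (2.36) (matching convention D-b06.38; = h̃_□ in the bulk, Part 2).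
[cite: Balaban1984PropagatorsII, (2.36) p.229] -/
noncomputable def hfun (k L M₀ : ℕ) (Ω : ℕ → Set (Site d)) (q : ℕ × Site d) (x : Site d) : ℝ :=
  htl k L M₀ Ω q x / Real.sqrt (sqS k L M₀ Ω x)

/-- The ≤ (k+1)·2^d candidate cubes at x (outside them h̃_□(x) = 0). [cite: Balaban1984PropagatorsII, p.229 before (2.36)] -/
def near (k L M₀ : ℕ) (x : Site d) : Finset (ℕ × Site d) :=
  (Finset.range (k + 1)).biUnion fun j => (winZ (side L M₀ j) x).image fun n => (j, n)

/-! ## §3  Level by level: Σ_{𝒟_j} h̃² = 1 on B^j(Λ_j); 1 ≤ S ≤ k + 1; (2.36) -/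

/-- A cube of 𝒟 has level ≤ k. [cite: Balaban1984PropagatorsII, p.229 before (2.36)] -/
theorem fst_le_of_mem_cover {q : ℕ × Site d} (h : q ∈ cover k L M₀ Ω) : q.1 ≤ k := by
  obtain ⟨x, hx, -⟩ := h
  exact le_of_mem_terr hx

open Classical in
/-- h̃_{(j,n)} unfolded. [cite: Balaban1984PropagatorsII, p.229 before (2.36)] -/
theorem htl_mk (j : ℕ) (n x : Site d) :
    htl k L M₀ Ω (j, n) x = if IsCtr k L M₀ Ω j n then bumpZ (side L M₀ j) n x else 0 := rfl

/-- A translate of level j felt at a point x OF B^j(Λ_j) is a cube of 𝒟_j (x is the witness). [cite: Balaban1984PropagatorsII, p.229 before (2.36)] -/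
theorem isCtr_of_bumpZ_ne_zero (hL : 1 ≤ L) (hM₀ : 1 ≤ M₀) {j : ℕ} {n x : Site d} (hx : x ∈ terr k Ω j)
    (h : bumpZ (side L M₀ j) n x ≠ 0) : IsCtr k L M₀ Ω j n := by
  refine ⟨x, hx, fun μ => ?_⟩
  have h1 := abs_lt_of_bumpZ_ne_zero (side_pos hL hM₀ j) h μ
  have h0 := abs_nonneg (x μ - (side L M₀ j : ℤ) * n μ)
  linarith

/-- Hence on B^j(Λ_j) the level-j family is the full lattice family. [cite: Balaban1984PropagatorsII, p.229 before (2.36)] -/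
theorem htl_of_mem_terr (hL : 1 ≤ L) (hM₀ : 1 ≤ M₀) {j : ℕ} {x : Site d} (hx : x ∈ terr k Ω j) (n : Site d) :
    htl k L M₀ Ω (j, n) x = bumpZ (side L M₀ j) n x := by
  rw [htl_mk]
  split_ifs with h
  exacts [rfl, (Classical.not_not.1 fun hne => h (isCtr_of_bumpZ_ne_zero hL hM₀ hx hne)).symm]

/-- **THE LEVEL-j IDENTITY**: Σ_{□∈𝒟_j} h̃_□(x)² = 1 at every x ∈ B^j(Λ_j) — the rescaled (1.118) for the family 𝒟_j alone
(no hypothesis on Ω). [cite: Balaban1984PropagatorsII, (2.36) p.229] -/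
theorem levelSum_eq_one (hL : 1 ≤ L) (hM₀ : 1 ≤ M₀) {j : ℕ} {x : Site d} (hx : x ∈ terr k Ω j) :
    ∑ n ∈ winZ (side L M₀ j) x, htl k L M₀ Ω (j, n) x ^ 2 = 1 := by
  rw [← sum_winZ_bumpZ_sq (side_pos hL hM₀ j) x]
  exact Finset.sum_congr rfl fun n _ => by rw [htl_of_mem_terr hL hM₀ hx]

/-- Every level contributes ≤ 1 at every point. [cite: Balaban1984PropagatorsII, (2.36) p.229] -/
theorem levelSum_le_one (hL : 1 ≤ L) (hM₀ : 1 ≤ M₀) (j : ℕ) (x : Site d) :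
    ∑ n ∈ winZ (side L M₀ j) x, htl k L M₀ Ω (j, n) x ^ 2 ≤ 1 := by
  rw [← sum_winZ_bumpZ_sq (side_pos hL hM₀ j) x]
  refine Finset.sum_le_sum fun n _ => ?_
  rw [htl_mk]
  split_ifs
  exacts [le_rfl, (zero_pow two_ne_zero).trans_le (sq_nonneg _)]

/-- **1 ≤ S** (the point's own level gives exactly 1). [cite: Balaban1984PropagatorsII, (2.36) p.229] -/
theorem one_le_sqS (hL : 1 ≤ L) (hM₀ : 1 ≤ M₀) (x : Site d) : 1 ≤ sqS k L M₀ Ω x :=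
  (levelSum_eq_one hL hM₀ (mem_terr_pzLevel x)).symm.le.trans
    (Finset.single_le_sum (f := fun j => ∑ n ∈ winZ (side L M₀ j) x, htl k L M₀ Ω (j, n) x ^ 2)
      (fun _ _ => Finset.sum_nonneg fun _ _ => sq_nonneg _)
      (Finset.mem_range.2 (Nat.lt_succ_of_le (pzLevel_le x))))

/-- **S ≤ k + 1**. [cite: Balaban1984PropagatorsII, (2.36) p.229] -/
theorem sqS_le (hL : 1 ≤ L) (hM₀ : 1 ≤ M₀) (x : Site d) : sqS k L M₀ Ω x ≤ k + 1 :=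
  (Finset.sum_le_sum fun j _ => levelSum_le_one (k := k) (Ω := Ω) hL hM₀ j x).trans (by simp)

/-- Local finiteness: h̃_□(x) = 0 outside the candidates `near`. [cite: Balaban1984PropagatorsII, p.229 before (2.36)] -/
theorem htl_eq_zero_of_not_mem_near (hL : 1 ≤ L) (hM₀ : 1 ≤ M₀) {q : ℕ × Site d} {x : Site d}
    (hq : q ∉ near k L M₀ x) : htl k L M₀ Ω q x = 0 := by
  unfold htl
  split_ifs with hc
  · by_contra hne
    refine hq (Finset.mem_biUnion.2 ⟨q.1, Finset.mem_range.2 (Nat.lt_succ_of_le (fst_le_of_mem_cover hc)), ?_⟩)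
    refine Finset.mem_image.2 ⟨q.2, ?_, rfl⟩
    by_contra hw
    exact hne (bumpZ_eq_zero_of_not_mem_winZ (side_pos hL hM₀ _) hw)
  · rfl

/-- S as ONE finite sum over the candidate cubes. [cite: Balaban1984PropagatorsII, (2.36) p.229] -/
theorem sqS_eq_sum_near (x : Site d) : sqS k L M₀ Ω x = ∑ q ∈ near k L M₀ x, htl k L M₀ Ω q x ^ 2 := by
  unfold sqS near
  rw [Finset.sum_biUnion]
  · refine Finset.sum_congr rfl fun j _ => ?_
    rw [Finset.sum_image fun n _ n' _ h => (Prod.ext_iff.1 h).2]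
  · intro j _ j' _ hne
    rw [Function.onFun, Finset.disjoint_left]
    intro q hq hq'
    obtain ⟨n, -, rfl⟩ := Finset.mem_image.1 hq
    obtain ⟨n', -, h⟩ := Finset.mem_image.1 hq'
    exact hne (Prod.ext_iff.1 h).1.symm

/-- **S(x) = Σ_{□∈𝒟} h̃_□(x)²** summed over ALL cubes (`finsum`; the family is locally finite). [cite: Balaban1984PropagatorsII, (2.36) p.229] -/
theorem sqS_eq_finsum (hL : 1 ≤ L) (hM₀ : 1 ≤ M₀) (x : Site d) :
    sqS k L M₀ Ω x = ∑ᶠ q, htl k L M₀ Ω q x ^ 2 := by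
  rw [sqS_eq_sum_near]
  refine (finsum_eq_sum_of_support_subset _ fun q hq => ?_).symm
  simp only [Function.mem_support, ne_eq] at hq
  by_contra h
  exact hq (by rw [htl_eq_zero_of_not_mem_near hL hM₀ h, zero_pow two_ne_zero])

/-- (2.36) as a finite sum over the candidate cubes at x. [cite: Balaban1984PropagatorsII, (2.36) p.229] -/
theorem sum_hfun_sq_near (hL : 1 ≤ L) (hM₀ : 1 ≤ M₀) (x : Site d) :
    ∑ q ∈ near k L M₀ x, hfun k L M₀ Ω q x ^ 2 = 1 := by
  have hS : 0 < sqS k L M₀ Ω x := lt_of_lt_of_le one_pos (one_le_sqS hL hM₀ x)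
  simp only [hfun, div_pow, Real.sq_sqrt hS.le, ← Finset.sum_div]
  rw [← sqS_eq_sum_near, div_self hS.ne']

/-- **(2.36) ON THE NESTED GEOMETRY: Σ_{□∈𝒟} h_□(x)² = 1 at every η-point x ∈ ℤ^d**, for every k, L ≥ 1, M₀ ≥ 1 and every
sequence Ω (a `finsum` over all cube indices; cubes ∉ 𝒟 carry h_□ = 0). [cite: Balaban1984PropagatorsII, (2.36) p.229] -/
theorem sum_h_sq_eq_one (hL : 1 ≤ L) (hM₀ : 1 ≤ M₀) (x : Site d) : ∑ᶠ q, hfun k L M₀ Ω q x ^ 2 = 1 := by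
  have hsub : (Function.support fun q => hfun k L M₀ Ω q x ^ 2) ⊆ ↑(near k L M₀ x) := by
    intro q hq
    simp only [Function.mem_support, ne_eq] at hq
    by_contra h
    exact hq (by rw [hfun, htl_eq_zero_of_not_mem_near hL hM₀ h, zero_div, zero_pow two_ne_zero])
  rw [finsum_eq_sum_of_support_subset _ hsub, sum_hfun_sq_near hL hM₀ x]

/-- (2.36) over any finite set of cubes containing the candidates at x. [cite: Balaban1984PropagatorsII, (2.36) p.229] -/
theorem sum_hfun_sq_of_near_subset (hL : 1 ≤ L) (hM₀ : 1 ≤ M₀) (x : Site d) {D : Finset (ℕ × Site d)}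
    (hD : near k L M₀ x ⊆ D) : ∑ q ∈ D, hfun k L M₀ Ω q x ^ 2 = 1 := by
  rw [← Finset.sum_subset hD fun q _ hq => by
    rw [hfun, htl_eq_zero_of_not_mem_near hL hM₀ hq, zero_div, zero_pow two_ne_zero]]
  exact sum_hfun_sq_near hL hM₀ x

/-! ## §4  The cover binders: T = ⋃_{□∈𝒟} □, supp h_□ ⊂ □, 0 ≤ h_□ ≤ 1 -/

/-- The cube OF x: its own level, centre index ⌊x∕M₀L^j⌋. [cite: Balaban1984PropagatorsII, p.229 before (2.36)] -/
noncomputable def ownCube (k L M₀ : ℕ) (Ω : ℕ → Set (Site d)) (x : Site d) : ℕ × Site d :=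
  (pzLevel k Ω x, fun μ => x μ / (side L M₀ (pzLevel k Ω x) : ℤ))

/-- |a − s⌊a∕s⌋| < s. [folklore] -/
private theorem abs_sub_mul_ediv_lt {s : ℕ} (hs : 0 < s) (a : ℤ) : |a - (s : ℤ) * (a / (s : ℤ))| < s := by
  rw [← Int.emod_def, abs_of_nonneg (Int.emod_nonneg _ (by exact_mod_cast hs.ne'))]
  exact Int.emod_lt_of_pos _ (by exact_mod_cast hs)

/-- **T = ⋃_{□∈𝒟} □** (i): the cube of x belongs to 𝒟 (witness x). [cite: Balaban1984PropagatorsII, p.229 before (2.36)] -/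
theorem ownCube_mem_cover (hL : 1 ≤ L) (hM₀ : 1 ≤ M₀) (x : Site d) : ownCube k L M₀ Ω x ∈ cover k L M₀ Ω :=
  ⟨x, mem_terr_pzLevel x, fun μ => abs_sub_mul_ediv_lt (side_pos hL hM₀ _) (x μ)⟩

/-- **T = ⋃_{□∈𝒟} □** (ii): x lies in its cube. [cite: Balaban1984PropagatorsII, p.229 before (2.36)] -/
theorem inCube_ownCube (hL : 1 ≤ L) (hM₀ : 1 ≤ M₀) (x : Site d) : InCube L M₀ (ownCube k L M₀ Ω x) x :=
  fun μ => (abs_sub_mul_ediv_lt (side_pos hL hM₀ _) (x μ)).le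

/-- **supp h_□ ⊂ supp h̃_□ ⊂ □** (the binder «□·h_□ = h_□» of (2.37), (2.70)); a cube felt anywhere belongs to 𝒟.
[cite: Balaban1984PropagatorsII, (2.36) p.229] -/
theorem inCube_of_hfun_ne_zero (hL : 1 ≤ L) (hM₀ : 1 ≤ M₀) {q : ℕ × Site d} {x : Site d}
    (h : hfun k L M₀ Ω q x ≠ 0) : q ∈ cover k L M₀ Ω ∧ InCube L M₀ q x := by
  have h' : htl k L M₀ Ω q x ≠ 0 := fun h0 => h (by rw [hfun, h0, zero_div])
  have hc : q ∈ cover k L M₀ Ω := by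
    by_contra hc
    exact h' (by rw [htl, if_neg hc])
  have hb : bumpZ (side L M₀ q.1) q.2 x ≠ 0 := by rwa [htl, if_pos hc] at h'
  refine ⟨hc, fun μ => ?_⟩
  have h1 := abs_lt_of_bumpZ_ne_zero (side_pos hL hM₀ q.1) hb μ
  have h0 := abs_nonneg (x μ - (side L M₀ q.1 : ℤ) * q.2 μ)
  linarith

/-- 0 ≤ h_□ ≤ 1. [cite: Balaban1984PropagatorsII, (2.36) p.229] -/
theorem hfun_mem_Icc (hL : 1 ≤ L) (hM₀ : 1 ≤ M₀) (q : ℕ × Site d) (x : Site d) :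
    hfun k L M₀ Ω q x ∈ Set.Icc (0 : ℝ) 1 := by
  have h1 : 1 ≤ Real.sqrt (sqS k L M₀ Ω x) := by simpa using Real.sqrt_le_sqrt (one_le_sqS hL hM₀ x)
  have hh : htl k L M₀ Ω q x ∈ Set.Icc (0 : ℝ) 1 := by
    unfold htl
    split_ifs
    · exact bumpZ_mem_Icc _ _ _
    · exact ⟨le_rfl, zero_le_one⟩
  exact ⟨div_nonneg hh.1 (by linarith), (div_le_one (by linarith)).2 (hh.2.trans h1)⟩

/-! ## §5  (2.3) in the model: the territories are Ω₁ᶜ, Ω_j∖Ω_{j+1}, Ω_k under the nesting (2.1) -/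

/-- (2.3), Λ₀ = Ω₁ᶜ (nesting (2.1), k ≥ 1). [cite: Balaban1984PropagatorsII, (2.3) p.224] -/
theorem terr_zero (hnest : Nested k Ω) (hk : 1 ≤ k) : terr k Ω 0 = (Ω 1)ᶜ := by
  ext x
  refine ⟨fun h h1 => ?_, fun h => ?_⟩
  · have := le_pzLevel hk h1
    rw [mem_terr.1 h] at this
    exact Nat.not_succ_le_zero 0 this
  · by_contra hne
    exact h (mem_of_le_pzLevel hnest le_rfl (Nat.one_le_iff_ne_zero.2 hne))

/-- (2.3), Λ_j = Ω_j∖Ω_{j+1} for 1 ≤ j ≤ k − 1 (nesting (2.1)). [cite: Balaban1984PropagatorsII, (2.3) p.224] -/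
theorem terr_mid (hnest : Nested k Ω) {j : ℕ} (hj : 1 ≤ j) (hjk : j < k) : terr k Ω j = Ω j \ Ω (j + 1) := by
  ext x
  refine ⟨fun h => ⟨mem_of_le_pzLevel hnest hj (mem_terr.1 h).ge, not_mem_of_pzLevel_lt ?_ hjk⟩, fun h => ?_⟩
  · rw [mem_terr.1 h]
    exact Nat.lt_succ_self j
  · have h1 := le_pzLevel hjk.le h.1
    by_contra hne
    have hne' : pzLevel k Ω x ≠ j := hne
    exact h.2 (mem_of_le_pzLevel hnest (Nat.succ_pos j) (by omega))

/-- (2.3), Λ_k = Ω_k (k ≥ 1, nesting (2.1)). [cite: Balaban1984PropagatorsII, (2.3) p.224] -/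
theorem terr_top (hnest : Nested k Ω) (hk : 1 ≤ k) : terr k Ω k = Ω k :=
  Set.ext fun x => ⟨fun h => mem_of_le_pzLevel hnest hk (mem_terr.1 h).ge,
    fun h => le_antisymm (pzLevel_le x) (le_pzLevel le_rfl h)⟩

end Cover

end Literature.MathematicalPhysics.QuantumFieldTheory.Balaban1983to89.B6CoverNested
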